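import Summits.BirchSwinnertonDyer.BirchSwinnertonDyer.Theses.UniversalToricDescent
import Summits.BirchSwinnertonDyer.BirchSwinnertonDyer.Theorems.EisensteinPrimesHidaLimitFittingBoundConverse
import Summits.BirchSwinnertonDyer.Rank1Residual.X11b.BDPRouteOpenInputDegenerateFrame
import Literature.NumberTheory.EllipticCurves.CyclotomicIwasawaMainTheoremIrreducibleProofs
import Literature.NumberTheory.EllipticCurves.Sprung2012.HondaSystemCyclotomicTowerPoints
import Mathlib.RingTheory.PowerSeries.Derivative
import HarnessLib

/-!
# NODE (D-0171) on crux stmt-BirchSwinnertonDyer-24207 `UniversalToricDescent.RationalSplitIMCInclusionAtThree`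
# — idea `torsion-anchored-reciprocity` (crux-ideate seat `cruxidea-stmt-BirchSwinnertonDyer-24207-1` gen 10, 2026-08-31)

KIND: REFORMULATION-WITH-A-DOOR (sufficient pair, not EQUIV; no child route) + two KERNEL-CERTIFIED BARRIER LEMMAS + a
CONVERGENCE DIAGNOSIS of the whole Euler-system direction of this crux.  The wall `∃ k, 3ᵏ·L ∈ Ch_Λ(X_(∅,0))·R₀⟦T⟧`
(RATWALL: O6 rows, `ρ̄₃` onto, `r_an = 1`, `3 = 𝔭𝔭'` split in the Heegner field, `X` strict at `𝔭'`, relaxed at the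
branch prime `𝔭`, `L` the squared BDP function) is entered through

        **A (torsion-anchored supply)** ∧ **T (torsion identity principle)** ⟹ 24207      (kernel, BY NAME, §2),

and §3 PROVES the dual barrier **B** `traceZero_forces_order_one` (with **B0'** `traceZero_noUniversalNorms`).

## THE LEVER — decide reciprocity laws AT TORSION CHARACTERS, using the ORDER GAP below 1

(O1) [literature leaf, INSTRUMENTABLE: ask L-g10-1]  Along a `ℤ₃`-line of characters of `K` the Λ-adic class `𝐳` of an
     Euler system for `V = V_f|G_{ℚ₃}` (de Rham, potentially supersingular, `D_pst` isoclinic of slope `½`) has a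
     Perrin-Riou/Colmez functional `𝓛_w(𝐳) = ⟨Log/Exp*(loc_w 𝐳), ω_f⟩` at each `w ∣ 3`, TEMPERED OF ORDER `h < 1`:
     `h = ½` at the prime where the line ramifies (height-one Lubin–Tate tower of `ℚ₃` for a uniformiser `π₀ ∈ 3ℤ₃^×`;
     Colmez 1998 «représentations de de Rham», Cherbonnier–Colmez 1999; the crystalline relative-LT case is the map
     `Col_v` of Castella arXiv:2407.11891 Thm 4.2.1 p.16 = [PR94, Kob23, CH22 §3]), and `h = 0` at a prime where the line
     is UNRAMIFIED (formal-group `exp*/log` with bounded denominators = the LEAD's K2(b-loc), `unramified-regulator` g48).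
(O2) ORDER-GAP UNIQUENESS [informal lemma; its order-0 case is the typed leaf **T**]: two elements of `𝓗_h⊗R₀`, `h < 1`,
     that agree at all but finitely many torsion points `ζ - 1` are EQUAL — their difference vanishes at almost every
     torsion point, so is divisible by `log(1+T)/(finite product of Φ_{3ⁿ})`, which has order `1 > h`.  At order `h ≥ 1`
     this FAILS (`log(1+T)` itself): that failure is exactly gen 4's kill of every order-1 (toric/Heegner) interpolation
     (B-g4-1, B-g5-4, B-g60-1) — a `log`-coset meets `𝓗_{<1}` in at most one point.
(O3) Hence a Λ-adic explicit reciprocity law `𝓛_w(𝐳) = Ψ` with `Ψ` KNOWN A PRIORI (`Ψ = pin·√L` on the anticyclotomic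
     line, `Ψ = L₂|_tooth` on a LEAD tooth; never square first) is DECIDED AT TORSION CHARACTERS `ψ₀`: it is equivalent to
     the family of pointwise identities
        (R1) rank-one rigidity `Sel(K, V_f ⊗ ψ₀) = ⟨P_ψ₀⟩` for almost all `ψ₀` [ATTACKABLE (L): Cornut–Vatsal 2007,
             Nekovář 2007 (CM points, any level), Bertolini–Darmon 1990 at `3 ∣ N`];
        (R2) finite-order `p`-adic Waldspurger `√L(ψ₀) = e(ψ₀)·log_ω P_ψ₀` at additive split 3 [ATTACKABLE (L): BDP 2013
             §5 verbatim for `f` as a Katz `3`-adic form of tame level `N'` + Besser–Zerbes (Vologodsky = Coleman on the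
             ordinary wide open of the stable model over `L″`) for the ONE-dimensional anchor `d⁻¹f|_𝒜` at CM points; tree
             `LiuZhangZhang2018.PAdicWaldspurgerEllipticCurveAdditive`];
        (R3) the COEFFICIENT IDENTITY `𝐳(ψ₀) = c(ψ₀)·P_ψ₀`, `c(ψ₀) = pin·e(ψ₀)` explicit [IDEA-NEEDED — the research leaf].
     EVERY torsion point of the toric two-variable plane is a RANK-ONE point: the toric function factors through the
     anticyclotomic projection, `L₂(λ) = c(λ)·L_ac(λ_ac)` (`λ·(λ|_ℚ)^{-1/2}∘N = λ_ac`; Waldspurger needs `λ|_{𝔸_ℚ} = ω⁻¹`),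
     so its zero set is a union of CYCLOTOMIC-direction cylinders over `Z(L_ac)`, the LEAD's teeth (`𝔭`-lines) cross them
     transversally, and at a finite-order `λ` the sign is `−1` (all finite places split/Heegner, `∞` definite for weight 2
     and finite order) — `L(f_K⊗λ_ac, 1) = 0`, GZ regime, `𝐳(λ)` Selmer.  So on the LEAD's teeth K2(b-val) («`p`-adic
     Beilinson VALUE formula at `j = 0`, `3 ∣ N`, OPEN», Lines/ratwall_thin_comb.md) may be REPLACED by K2(b-tors): (R3') the
     weight-(2,1) identity `BF⁽²'¹⁾(f⊗ε, θ_λ) = c(λ)·P_{λ_ac}` for infinitely many torsion `λ` on each tooth (order 0 at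
     `𝔭'`: T suffices, no O2 needed); and gen 9's leaf R (rank-two tempered reciprocity on `u = 0`) is EQUIVALENT, given O1,
     to the weight-(2,1,1) identities T(ψ₀) = (R3) for almost all anticyclotomic torsion `ψ₀`.

## B-g10-1 — THE ORDER-ONE DUALITY (barrier note; §3 is its kernel-certified half)
Heegner/CM layer data at additive split 3 has KNOWN torsion values (R2) but trace ZERO (`U₃ f_E = 0`,
`TraceZeroHeegnerTowerAtAdditiveSplitP`), and **B** proves: ANY interpolation of a trace-zero tower with sub-linear
denominators vanishes — nonzero interpolations have order `≥ 1`, exactly where O2/T fail.  Euler-system classes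
(Beilinson–Flach on `𝔭`-lines, `f`-frozen CM-pair diagonal classes) are BOUNDED with order-`0`/`½` functionals, where
O2/T bite, but their torsion COEFFICIENTS `c(ψ₀)` are unknown.  The crux's Euler-system direction is therefore exactly:
«lower the order of Heegner interpolation below 1» (impossible by **B**) or «learn the torsion coefficients of a bounded
class» (= R3/R3').  The ±/♯♭ escape of the good supersingular case (Kobayashi, Sprung, BKO, Castella–Wan, CHKLL
arXiv:2308.10474 §7 Thm 7.1 p.29) is an order-`< 1` re-weighting made possible by the link `Tr P_{n+1} = a_p P_n − P_{n−1}`;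
with `Tr = 0` there is no link across layers (B0': no universal norms at all).

## B-g10-2 — CONVERGENCE: every in-print road to (R3)/(R3') is a Λ-adic ERL from NON-CRITICAL geometric anchors at 3 ∣ N
(i) For weight-2 `f` every motivic Beilinson–Flach class `BF^{[f,g_l,j]}` has `j = 0` (KLZ: `j ≤ min(k,l')`, `k = 0`), and
`s = 1` is non-critical for `L(f⊗g_l, s)` when `l ≥ 3` (critical strip `[2, l−1]`) and for `l = 2` (equal weights: no
critical values): Kato's generic-ordinary-point `exp*` reciprocity (any level) never applies; only the `log`/syntomic side
does — on `Y₀(27N')×Y`, bad reduction at 3.  (ii) The weight-one specialisations (R3') are `p`-adic limits; in print their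
`exp*/log` are ONLY ever obtained by specialising a Λ-adic ERL (BDR2, KLZ17 Thm B via KLZ15b syntomic regulators, `p ∤ N`);
DLR's iterated integrals are the analytic side by definition.  (iii) For the `f`-frozen CM-pair diagonal class the balanced
anchors `(2,l,l)` WITH NEBENTYPES `(ζ(1+p)^{l−1}−1, ζ'(1+p)^{l−1}−1)` lie on the infinitely many lines `v = ζ/ζ'` and ARE
Zariski dense in the `(s,t)`-plane (correction C-g10-1 of a worry raised and settled this gen; the weight-(1,1) point lies
on `v = 0`), so gen 9's brief (b) is VIABLE — modulo the same anchor computation (p-adic Abel–Jacobi of `Δ_{2,l,l}` on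
`X₀(27N')×X×X`, `f` entering only through `d⁻¹f|_𝒜`, `e_ord` on the CM slots).  (iv) That anchor computation is ONE
object across the lineage: LEAD K2(b-val) = gen-9 R's anchors = the lineage card `stable-fibre-regulator` (crux 20395,
utd-idea g42; refine-never-refile).  Torsion anchoring (this node) is the only formulation of the residue that is
HORIZONTAL (no tower at 3, rank-one points, Heegner points present) — it does not remove the residue.
(v) Kato–Eisenstein torsion points: `θ_λ` is Eisenstein iff `λ = λ^c`, i.e. `λ` on the CYCLOTOMIC line; there (R3') IS in
print (BDR2: `BF(f, E₁(χ,χε_K))` = Kato's class; Kato 2004 Thm 12.5, any level).  Each LEAD tooth meets the cyclotomic line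
in ONE torsion point — one free anchor per tooth, dense on no tooth: insufficient alone (recorded so it is not retried).

PIECES / TAGS: **A** UNDECIDED · door-half · EQUIV-mod-T (`torsionAnchoredSupply_of_wall`); **T** WEAKER · ATTACKABLE (M)
(⟸ gen-9 `DiscZerosFinite` + existence of values + `‖ζ−1‖ < 1`); **B, B0, B0'** BARRIER · PROVED (pure algebra, §3).
LEAVES: (R3)/(R3') IDEA-NEEDED (= K2(b-val)-class, B-g10-2(iv)); (O1) INSTRUMENTABLE (literature, L-g10-1); (R1),(R2)
ATTACKABLE (L); Kolyvagin-system bound `char X ∣ 3ᵃ·Φ` on a tooth / on `u = 0`: as LEAD K2-rat(a) / gen-9 (A), unchanged.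

WHY NOVEL (one sentence): no card or line on file uses the ORDER of the regulator as a rigidity resource — gen 7 anchors
at accumulating BDP points (Strassmann), gen 9 pins a `p`-adic constant, the LEAD anchors at non-critical `j = 0` points;
deciding the law at the Zariski-dense, non-accumulating TORSION characters (legal for identities, B-g7-1 only forbids it
for divisibilities) converts every Λ-adic reciprocity leaf of this crux into horizontal weight-one statements over Heegner
points, and the same order bookkeeping PROVES (§3) why no re-weighting of Heegner data can ever replace them.

KEEP/KILL g10 (no instrument/vet output since gen 5; verdicts by argument): universal-toric-half-order KILLED (B-g60-1,
now structural: **B**); germ-recentred KILLED (B-g5-4 = O2 at order 1); base-doubling KEEP (local tool); eisenstein-kato-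
swap KEEP (note: an alternative P2' — `v₃`-equality at ONE torsion point, e.g. exact 3-part of BSD over `K` at `𝟙`, also
turns P1 into the wall: `A ∣ B`, `v(A(0)) = v(B(0))` ⇒ cofactor unit); adic-congruence-ladder KEEP pending D-g2-1/2;
nonsplit-patching KEEP; bounded-resolvent KEEP as door; root-trichotomy KEEP as reduction node; endoscopic-accumulating
KEEP pending F1; derived-antidiagonal KEEP-CORRECTED (B-g9-1); frozen-channel-padic-pin LIVE (its (b) confirmed viable by
B-g10-2(iii); its R ⟺ T(ψ₀) by O3; F-g8-1 still load-bearing).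

ASKS: L-g10-1 (order of Colmez's `Log_V·ω_f` along the `π₀`-Lubin–Tate `ℤ₃`-line for pot.-crystalline slope-½ `V`:
exactly ½? ≥ 1 voids O2 on ramified lines — not T), K-g10-1 (LOAD-BEARING literature check: does KLZ17's proof of the
`g`-dominant law Thm B use KLZ15b's syntomic anchors, or only Ohta + Kato's Λ-adic Eisenstein regulator + Hida?  if the
latter, K2(b-val) for frozen non-ordinary `f` with `27 ∣ N` may be MODEL-FREE), L-g10-2 (a cusp-local/Kato-style `exp*`
formula for `BF⁽²'¹⁾(f, θ_χ)` without `f`-ordinarity — in print?), carried: F-g8-1, A-g9-1, E-g9-1, D-g7-1/2/3, F1, D-g6-1,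
D-g5-1, D-g2-1/2.  INSTRUMENT DATA CITED: none new since gen 5.  Disproof.lean / Negative/: none on file for 24207
(`ledger negatives`: 15532, 24881 — disjoint).  Dead lines honoured: 24208 `kernel_rat` RK-6 v2 (this node never types a
kernel statement), 24209 dropped, RK-7 v1.
-/

set_option linter.dupNamespace false

open scoped Classical

namespace Summit.BirchSwinnertonDyer.BirchSwinnertonDyer.Cruxes.RationalSplitIMCInclusionAtThree.TorsionAnchoredReciprocity

open PowerSeries Literature.NumberTheory.EllipticCurves Summit.BirchSwinnertonDyer.Rank1Residual.X11b

/-! ## §1 Torsion points of the open disc and agreement of two elements of `R₀⟦T⟧` on a set -/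

/-- The TORSION POINTS of the open unit disc of `ℂ₃`: `x = ζ - 1` with `ζ` a `3`-power root of unity (the points
`T = ψ₀(γ) - 1` of the finite-order characters `ψ₀` of `Γ^ac ≅ ℤ₃` under `γ ↦ 1 + T`). -/
def torsionPoints : Set ℂ_[3] := {x | ∃ (n : ℕ) (ζ : ℂ_[3]), IsPrimitiveRoot ζ (3 ^ n) ∧ x = ζ - 1}

/-- `F` and `G` AGREE ON `S`: at every point of `S` where both have a value, the values coincide (values in the
sense of the tree's `UnrSeries.HasValueAt`; on the open disc values of elements of `R₀⟦T⟧` exist, so this is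
genuine agreement there). -/
def AgreeOn (F G : UnrSeries 3) (S : Set ℂ_[3]) : Prop :=
  ∀ x ∈ S, ∀ v w : ℂ_[3], F.HasValueAt x v → G.HasValueAt x w → v = w

/-- **T [WEAKER · ATTACKABLE (M)] — torsion identity principle for `R₀⟦T⟧` (the ORDER-ZERO case of the order-gap
lemma).**  Two elements of `R₀⟦T⟧` that agree at infinitely many torsion points are equal.  (Proof for a prover:
`‖ζ - 1‖ < 1`; values exist on the open disc; `F - G ≠ 0` has finitely many disc zeros by Weierstrass preparation over
the complete DVR `R₀` — the gen-9 leaf `DiscZerosFinite`.)  It FAILS for tempered functions of order `≥ 1`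
(`log(1+T)` vanishes at every torsion point) and HOLDS for order `< 1` (informal order-gap lemma O2 of the header):
that gap is the lever of this node. [Washington GTM 83 §7.1; Lang, Cyclotomic Fields I–II, Ch. 5 §2] -/
def TorsionIdentityPrinciple : Prop :=
  ∀ F G : UnrSeries 3, ∀ S : Set ℂ_[3], S ⊆ torsionPoints → S.Infinite → AgreeOn F G S → F = G

/-! ## §2 The supply (door-half) and the composition -/

/-- **A [UNDECIDED · door-half · IDEA-NEEDED on its producer (R3) · EQUIV-mod-T with the wall — costume check
`torsionAnchoredSupply_of_wall`]** TORSION-ANCHORED SUPPLY at `p = 3`: on the wall's binders, with `X_(∅,0)` torsion and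
`Ch_Λ(X)·R₀⟦T⟧ = (F)`, there are a BOUNDED `Φ ∈ R₀⟦T⟧` with `3ᵃ·Φ ∈ (F)` (an Euler/Kolyvagin-system bound
`char X ∣ 3ᵃ·Φ`, `Φ` = the image of a Λ-adic class under an ORDER-ZERO Coleman functional), a unit `u`, an exponent `b`
and an INFINITE set `S` of torsion points on which `Φ` and `u·3ᵇ·L` agree (the reciprocity law DECIDED AT TORSION
CHARACTERS: (R1) rank-one rigidity `Sel(K, V_f ⊗ ψ₀) = ⟨P_ψ₀⟩`, (R2) finite-order `p`-adic Waldspurger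
`L(ψ₀) = e(ψ₀)·log_ω(P_ψ₀)²`, (R3) the coefficient identity `𝐳(ψ₀) = c(ψ₀)·P_ψ₀` with `c(ψ₀)` EXPLICIT — the research
leaf).  See the header for why (R3) is the unique open input and where it converges with the LEAD's K2(b-val). -/
def TorsionAnchoredSupplyAtThree : Prop :=
  ∀ (W : WeierstrassCurve ℚ) [W.IsElliptic] [W.IsGloballyMinimal] (N : ℕ) [NeZero N] (K : Type) [Field K] [NumberField K] (Dt : Literature.NumberTheory.EllipticCurves.ModularForms.ModularParametrizationData W N), Summit.BirchSwinnertonDyer.Rank1Residual.Additive.ClassO6 W 3 → W.HasSurjectiveModNGaloisRep 3 → W.analyticRank = 1 → W.conductorNorm ℤ = N → Literature.NumberTheory.EllipticCurves.IsImaginaryQuadratic K → Literature.NumberTheory.EllipticCurves.SatisfiesHeegnerHypothesis N K → ∀ (κ : Literature.NumberTheory.EllipticCurves.ZpExtension K 3), κ.IsAnticyclotomic → ∀ (γ : Field.absoluteGaloisGroup K) [Fact (κ.IsTopGenerator γ)] (𝔭 : IsDedekindDomain.HeightOneSpectrum (NumberField.RingOfIntegers K)), ((3 : ℕ) : NumberField.RingOfIntegers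 K) ∈ 𝔭.asIdeal → 𝔭.asIdeal.ramificationIdx (NumberField.RingOfIntegers ℚ) = 1 → 𝔭.asIdeal.inertiaDeg (NumberField.RingOfIntegers ℚ) = 1 → ∀ (𝔭' : IsDedekindDomain.HeightOneSpectrum (NumberField.RingOfIntegers K)), ((3 : ℕ) : NumberField.RingOfIntegers K) ∈ 𝔭'.asIdeal → 𝔭' ≠ 𝔭 → ∀ (ι' : PadicAlgCl 3 ≃+* ℂ), Summit.BirchSwinnertonDyer.BirchSwinnertonDyer.Theorems.SchneiderFree.BranchInducesPrime 3 ι' 𝔭 → ∀ (ΩK : ℂ) (Ωp : ℂ_[3]) (L : Literature.NumberTheory.EllipticCurves.UnrSeries 3), ΩK ≠ 0 → Ωp ≠ 0 → Literature.NumberTheory.EllipticCurves.IsBDPLFunction ι' 𝔭 κ γ Dt.f ΩK Ωp L → Module.IsTorsion (Literature.NumberTheory.EllipticCurves.IwasawaAlgebra 3) (Summit.BirchSwinnertonDyer.Rank1Residual.X11b.AcSelmer.XAc (W.baseChange K) 3 κ 𝔭' ∅ γ) → ∀ F : Literature.NumberTheory.EllipticCurves.UnrSeries 3, (Summit.BirchSwinnertonDyer.Rank1Residual.X11b.AcSelmer.XAc.charIdeal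 (W.baseChange K) 3 κ 𝔭' ∅ γ).map (PowerSeries.map (Summit.BirchSwinnertonDyer.Rank1Residual.X11b.Halves.toUnr 3)) = Ideal.span {F} →
    ∃ (a b : ℕ) (Φ : Literature.NumberTheory.EllipticCurves.UnrSeries 3) (u : (Literature.NumberTheory.EllipticCurves.UnrSeries 3)ˣ) (S : Set ℂ_[3]),
      ((3 : ℕ) : Literature.NumberTheory.EllipticCurves.UnrSeries 3) ^ a * Φ ∈ Ideal.span {F} ∧ S ⊆ torsionPoints ∧ S.Infinite ∧
        AgreeOn Φ ((u : Literature.NumberTheory.EllipticCurves.UnrSeries 3) * ((3 : ℕ) : Literature.NumberTheory.EllipticCurves.UnrSeries 3) ^ b * L) S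

/-! ### Helper facts (gen-3…9 currency, verbatim) -/

/-- The extended characteristic ideal is principal: `Ch_Λ(X)·R₀⟦T⟧ = (F)`. -/
theorem exists_map_charIdeal_eq_span {K : Type} [Field K] [NumberField K] (W : WeierstrassCurve K)
    (κ : ZpExtension K 3) (𝔭' : IsDedekindDomain.HeightOneSpectrum (NumberField.RingOfIntegers K))
    (γ : Field.absoluteGaloisGroup K) [Fact (κ.IsTopGenerator γ)] :
    ∃ F : UnrSeries 3, (AcSelmer.XAc.charIdeal W 3 κ 𝔭' ∅ γ).map (PowerSeries.map (Halves.toUnr 3)) =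
      Ideal.span {F} := by
  obtain ⟨f, hf⟩ := (charIdeal_isPrincipal_holds 3 (AcSelmer.XAc W 3 κ 𝔭' ∅ γ)).principal
  refine ⟨PowerSeries.map (Halves.toUnr 3) f, ?_⟩
  have hf' : AcSelmer.XAc.charIdeal W 3 κ 𝔭' ∅ γ = Ideal.span {f} := by
    change Literature.NumberTheory.EllipticCurves.Module.charIdeal (IwasawaAlgebra 3) (AcSelmer.XAc W 3 κ 𝔭' ∅ γ) =
      Ideal.span {f}
    simpa [Ideal.submodule_span_eq] using hf
  rw [hf', Ideal.map_span, Set.image_singleton]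

/-- Agreement is reflexive (uniqueness of values). -/
theorem agreeOn_refl (F : UnrSeries 3) (S : Set ℂ_[3]) : AgreeOn F F S :=
  fun _ _ _ _ hv hw ↦ hv.unique hw

/-- The torsion points form an infinite set (`ℂ₃` contains a primitive `3ⁿ`-th root of unity for every `n`, e.g. the
image of the tree's `Sprung2012.Honda.PadicCyclotomicTower.zeta 3 n ∈ ℚ̄₃`; distinct `n` give distinct orders, hence distinct points). -/
theorem torsionPoints_infinite : torsionPoints.Infinite := by
  let ξ : ℕ → ℂ_[3] := fun n ↦ algebraMap (PadicAlgCl 3) ℂ_[3] (Sprung2012.Honda.PadicCyclotomicTower.zeta 3 n) - 1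
  have hξ : ∀ n, IsPrimitiveRoot (ξ n + 1) (3 ^ n) := fun n ↦ by
    simpa [ξ] using (Sprung2012.Honda.PadicCyclotomicTower.isPrimitiveRoot_zeta 3 n).map_of_injective
      (algebraMap (PadicAlgCl 3) ℂ_[3]).injective
  have hinj : Function.Injective ξ := by
    intro m n hmn
    have h1 : IsPrimitiveRoot (ξ n + 1) (3 ^ m) := hmn ▸ hξ m
    have h2 : 3 ^ m = 3 ^ n := IsPrimitiveRoot.unique h1 (hξ n)
    exact Nat.pow_right_injective (by norm_num : 2 ≤ 3) h2
  have hmem : ∀ n, ξ n ∈ torsionPoints := fun n ↦ ⟨n, ξ n + 1, hξ n, by simp⟩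
  exact Set.infinite_of_injective_forall_mem hinj hmem

/-- **A ∧ T ⟹ 24207 (kernel, BY NAME).**  If `X_(∅,0)` is not Λ-torsion its characteristic ideal is `⊤` (`k = 0`).
Otherwise `Ch·R₀⟦T⟧ = (F)`; A gives `3ᵃ·Φ ∈ (F)` and agreement of `Φ` with `u·3ᵇ·L` on an infinite torsion set; T
upgrades the agreement to the IDENTITY `Φ = u·3ᵇ·L` in `R₀⟦T⟧`; hence `3^{a+b}·L = u⁻¹·(3ᵃ·Φ) ∈ (F)`. -/
theorem rationalSplitIMCInclusionAtThree_of_torsionAnchoredSupply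
    (hA : TorsionAnchoredSupplyAtThree) (hT : TorsionIdentityPrinciple) :
    Summit.BirchSwinnertonDyer.BirchSwinnertonDyer.Theses.UniversalToricDescent.RationalSplitIMCInclusionAtThree := by
  intro W _ _ N _ K _ _ Dt hO6 hsurj hr1 hN hK hH κ hκ γ _ 𝔭 h𝔭 he hf 𝔭' h𝔭' hne ι' hι ΩK Ωp L hΩK hΩp hL
  by_cases htor : Module.IsTorsion (IwasawaAlgebra 3) (AcSelmer.XAc (W.baseChange K) 3 κ 𝔭' ∅ γ)
  · obtain ⟨F, hF⟩ := exists_map_charIdeal_eq_span (W.baseChange K) κ 𝔭' γ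
    obtain ⟨a, b, Φ, u, S, hΦ, hS, hSinf, hagree⟩ := hA W N K Dt hO6 hsurj hr1 hN hK hH κ hκ γ 𝔭 h𝔭 he hf 𝔭' h𝔭'
      hne ι' hι ΩK Ωp L hΩK hΩp hL htor F hF
    have hid : Φ = (u : UnrSeries 3) * ((3 : ℕ) : UnrSeries 3) ^ b * L := hT Φ _ S hS hSinf hagree
    refine ⟨a + b, ?_⟩
    have key : ((3 : ℕ) : UnrSeries 3) ^ (a + b) * L =
        (u⁻¹ : (UnrSeries 3)ˣ) * (((3 : ℕ) : UnrSeries 3) ^ a * Φ) := by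
      rw [hid]
      have : ((3 : ℕ) : UnrSeries 3) ^ a * ((u : UnrSeries 3) * ((3 : ℕ) : UnrSeries 3) ^ b * L) =
          (u : UnrSeries 3) * (((3 : ℕ) : UnrSeries 3) ^ (a + b) * L) := by ring
      rw [this, Units.inv_mul_cancel_left]
    rw [hF, key]
    exact Ideal.mul_mem_left _ _ hΦ
  · refine ⟨0, ?_⟩
    have htop : AcSelmer.XAc.charIdeal (W.baseChange K) 3 κ 𝔭' ∅ γ = ⊤ :=
      Summit.BirchSwinnertonDyer.BirchSwinnertonDyer.Theorems.charIdeal_eq_top_of_not_isTorsion (p := 3) _ htor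
    rw [htop, Ideal.map_top]; exact Submodule.mem_top

/-- **Costume check (evidence for the EQUIV-mod-T tag of A):** the wall gives A with `Φ := 3ᵏ·L`, `a := 0`, `u := 1`,
`b := k`, `S :=` all torsion points.  So A carries content only through its informal producer (an order-zero Coleman
image of a Λ-adic class plus torsion coefficient identities); the typed residue T is pure `R₀⟦T⟧`-algebra. -/
theorem torsionAnchoredSupply_of_wall
    (h : Summit.BirchSwinnertonDyer.BirchSwinnertonDyer.Theses.UniversalToricDescent.RationalSplitIMCInclusionAtThree) :
    TorsionAnchoredSupplyAtThree := by
  intro W _ _ N _ K _ _ Dt hO6 hsurj hr1 hN hK hH κ hκ γ _ 𝔭 h𝔭 he hf 𝔭' h𝔭' hne ι' hι ΩK Ωp L hΩK hΩp hL _ F hF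
  obtain ⟨k, hk⟩ := h W N K Dt hO6 hsurj hr1 hN hK hH κ hκ γ 𝔭 h𝔭 he hf 𝔭' h𝔭' hne ι' hι ΩK Ωp L hΩK hΩp hL
  refine ⟨0, k, ((3 : ℕ) : UnrSeries 3) ^ k * L, 1, torsionPoints, ?_, subset_rfl, torsionPoints_infinite, ?_⟩
  · rw [pow_zero, one_mul, ← hF]; exact hk
  · rw [Units.val_one, one_mul]; exact agreeOn_refl _ _

/-! ## §3 The dual barrier, kernel-certified: a TRACE-ZERO tower has no bounded and no sub-linear interpolation -/

/-- **B0 (PROVED).**  A TRACE-ZERO TOWER: abelian groups `M n` (layer-`n` data, e.g. `E(K[3ⁿ]) ⊗ ℤ₃` or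
`H¹(K_n, T)`-parts generated by layer classes), retractions `π n : M (n+1) → M n` onto the old part, and norm `N = 3·π`
(the trace is multiplication by `3` on the old part and ZERO on the new part — `U₃ f_E = 0`,
`Literature.Barriers.BirchSwinnertonDyer.TraceZeroHeegnerTowerAtAdditiveSplitP`).  Then every norm-compatible INTEGRAL
sequence (`3·π(z_{n+1}) = z_n`) is `3`-divisible to all orders at every level. -/
theorem traceZero_normCompatible_divisible {M : ℕ → Type*} [∀ n, AddCommGroup (M n)]
    (π : ∀ n, M (n + 1) →+ M n) (z : ∀ n, M n) (hz : ∀ n, (3 : ℤ) • π n (z (n + 1)) = z n) :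
    ∀ k n : ℕ, ∃ y : M n, z n = (3 : ℤ) ^ k • y := by
  intro k
  induction k with
  | zero => intro n; exact ⟨z n, by simp⟩
  | succ k ih =>
    intro n
    obtain ⟨y, hy⟩ := ih (n + 1)
    refine ⟨π n y, ?_⟩
    rw [← hz n, hy, map_zsmul, smul_smul, ← pow_succ']

/-- **B0' (PROVED) — no universal norms.**  In a trace-zero tower whose layers are `3`-adically separated, the only
norm-compatible integral sequence is `0`: NO element of `H¹_Iw` (order `0`) is built from trace-zero layer classes.
This is the structural form of the trace-zero barrier used by every generation of this lineage. -/
theorem traceZero_noUniversalNorms {M : ℕ → Type*} [∀ n, AddCommGroup (M n)]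
    (π : ∀ n, M (n + 1) →+ M n)
    (hsep : ∀ n (x : M n), (∀ k : ℕ, ∃ y : M n, x = (3 : ℤ) ^ k • y) → x = 0)
    (z : ∀ n, M n) (hz : ∀ n, (3 : ℤ) • π n (z (n + 1)) = z n) : ∀ n, z n = 0 :=
  fun n ↦ hsep n (z n) (fun k ↦ traceZero_normCompatible_divisible π z hz k n)

/-- Iterated retraction `M n → M 0`. -/
def piIter {M : ℕ → Type*} [∀ n, AddCommGroup (M n)] (π : ∀ n, M (n + 1) →+ M n) : ∀ n, M n →+ M 0
  | 0 => AddMonoidHom.id (M 0)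
  | n + 1 => (piIter π n).comp (π n)

/-- **B (PROVED) — `TraceZeroForcesOrderOne`, the structural form of B-g60-1.**  A TEMPERED interpolation of a
trace-zero tower with denominator profile `e` — integral numerators `y n` with `3·π(y_{n+1}/3^{e(n+1)}) = y_n/3^{e n}`,
i.e. `3^{e n + 1}·π(y_{n+1}) = 3^{e(n+1)}·y_n` — whose denominators are SUB-LINEAR (`n - e n` unbounded: "order `< 1`")
has `y 0 = 0` (and, shifting the tower, vanishes identically).  Hence every nonzero interpolation of trace-zero layer
classes (Heegner points `P_n`, layer Beilinson–Flach classes at `U₃ f = 0`) has order EXACTLY `≥ 1` — precisely the order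
at which the torsion identity principle T / the order-gap lemma O2 FAILS (`log(1+T)`).  This is the duality of the header:
Heegner data has KNOWN torsion values but only order-`≥ 1` interpolations; Euler-system classes have order-`0`
functionals but UNKNOWN torsion coefficients. -/
theorem traceZero_forces_order_one {M : ℕ → Type*} [∀ n, AddCommGroup (M n)] [∀ n, NoZeroSMulDivisors ℤ (M n)]
    (π : ∀ n, M (n + 1) →+ M n)
    (hsep : ∀ x : M 0, (∀ k : ℕ, ∃ y : M 0, x = (3 : ℤ) ^ k • y) → x = 0)
    (e : ℕ → ℕ) (y : ∀ n, M n)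
    (hy : ∀ n, (3 : ℤ) ^ (e n + 1) • π n (y (n + 1)) = (3 : ℤ) ^ e (n + 1) • y n)
    (hsub : ∀ k : ℕ, ∃ n : ℕ, e n + k ≤ n) : y 0 = 0 := by
  -- C(n): `3^{e 0 + n} • πIter n (y n) = 3^{e n} • y 0`
  have h3 : ∀ m : ℕ, ((3 : ℤ) ^ m) ≠ 0 := fun m ↦ pow_ne_zero _ (by norm_num)
  have C : ∀ n, (3 : ℤ) ^ (e 0 + n) • piIter π n (y n) = (3 : ℤ) ^ e n • y 0 := by
    intro n
    induction n with
    | zero => simp [piIter]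
    | succ n ih =>
      apply smul_right_injective (M 0) (h3 (e n))
      -- multiply both sides by `3^{e n}` and compute
      change (3 : ℤ) ^ e n • ((3 : ℤ) ^ (e 0 + (n + 1)) • piIter π (n + 1) (y (n + 1))) =
        (3 : ℤ) ^ e n • ((3 : ℤ) ^ e (n + 1) • y 0)
      have step : (3 : ℤ) ^ e n • ((3 : ℤ) ^ (e 0 + (n + 1)) • piIter π (n + 1) (y (n + 1))) =
          (3 : ℤ) ^ (e 0 + n) • piIter π n ((3 : ℤ) ^ (e n + 1) • π n (y (n + 1))) := by
        simp only [piIter, AddMonoidHom.coe_comp, Function.comp_apply, map_zsmul, smul_smul]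
        congr 1; ring
      rw [step, hy n, map_zsmul, smul_smul, mul_comm, ← smul_smul, ih, smul_smul, smul_smul, mul_comm]
  apply hsep
  intro k
  obtain ⟨n, hn⟩ := hsub k
  have hC := C n
  -- `e 0 + n = e n + (e 0 + n - e n)` with `e 0 + n - e n ≥ k`
  obtain ⟨d, hd⟩ : ∃ d, e 0 + n = e n + (k + d) := ⟨e 0 + n - e n - k, by omega⟩
  rw [hd, pow_add, ← smul_smul] at hC
  have hC' : y 0 = (3 : ℤ) ^ (k + d) • piIter π n (y n) := (smul_right_injective (M 0) (h3 (e n)) hC).symm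
  exact ⟨(3 : ℤ) ^ d • piIter π n (y n), by rw [hC', pow_add, smul_smul]⟩

end Summit.BirchSwinnertonDyer.BirchSwinnertonDyer.Cruxes.RationalSplitIMCInclusionAtThree.TorsionAnchoredReciprocity
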